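import Literature.NumberTheory.EllipticCurves.WeierstrassPDivisionValues
import Literature.NumberTheory.EllipticCurves.EisensteinSeriesNebentypusLattice
import Literature.NumberTheory.LFunctions.DirichletLValueBernoulli
import HarnessLib

/-!
# The `q`-expansion of `S_χ(τ) = ∑_{e mod N} χ̄(e) ℘_{Λ_τ}(e/N)` (weight `2`, character `χ`)

Topic `Literature/NumberTheory/EllipticCurves`; namespace
`Literature.NumberTheory.EllipticCurves.ModularForms`.  THEOREMS ONLY.

For a Dirichlet character `χ ≠ 1` modulo `N` the `χ̄`-combination `S_χ = ∑_e χ̄(e) f_{(0,e)}` of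
the `℘`-division values (`weierstrassPDivChar`, `WeierstrassPDivisionValues`) is an ABSOLUTELY
convergent lattice sum in which the level-one part cancels (`∑_e χ̄(e) = 0`); grouping the lattice
points by residues modulo `N` turns it into the weight-`2` analogue of the Eisenstein lattice sum
with character (`EisensteinSeriesNebentypusLattice`):

  `S_χ(τ) = N² ∑_{c ∈ ℤ} R_c(τ)`,  `R_c(τ) = ∑_{d ∈ ℤ} χ̄(d) (Ncτ + d)^{-2}`

(`weierstrassPDivChar_eq_tsum_rows`; the family `c ↦ R_c` IS summable although the double
family `(c, d)` is not).  The rows are then evaluated exactly as in weight `k ≥ 3`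
(`charRowTwo_zero`, `charRowTwo_pos`: Lipschitz + Gauss sums, here copied at `k = 2`), giving
for `χ` PRIMITIVE, non-trivial and EVEN (`weierstrassPDivChar_eq_qExpansion`)

  `S_χ(τ) = 2N² L(2, χ̄) + 2 (-2πi)² W(χ̄) ∑_{n ≥ 1} σ_1^χ(n) qⁿ`
         `= 2N² L(2, χ̄) - 8π² W(χ̄) ∑_{n ≥ 1} (∑_{d ∣ n} χ(d) d) qⁿ`,

i.e. `S_χ = -8π² W(χ̄) E_2^{𝟙,χ}(τ)` with `E_2^{𝟙,χ} = -B_{2,χ}/4 + ∑ σ_1^χ(n) qⁿ`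
(Diamond–Shurman Thm. 4.6.2 / (4.33) with `ψ = 𝟙`, `φ = χ`; Miyake Thm. 7.2.12).

## References

* F. Diamond, J. Shurman, *A First Course in Modular Forms*, GTM 228 (2005), §4.6, §4.8.
  [DiamondShurman2005]
* T. Miyake, *Modular Forms*, Springer (2006), Thm. 7.1.3, Thm. 7.2.12. [Miyake2006]
-/

noncomputable section

open UpperHalfPlane EisensteinSeries Complex Filter Finset Literature.NumberTheory.LFunctions

open scoped Real MatrixGroups

namespace Literature.NumberTheory.EllipticCurves.ModularForms

/-! ### Rows with character in weight `2` (the `k = 2` case of `EisensteinSeriesNebentypusLattice`) -/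

section RowsTwo

variable {N : ℕ} [NeZero N] (ψ : DirichletCharacter ℂ N) (z : ℍ)

omit [NeZero N] in
/-- The weight-`2` row `d ↦ ψ(d) (Nmz + d)^{-2}` is (absolutely) summable. [folklore] -/
theorem summable_charRowTwo (m : ℤ) :
    Summable fun d : ℤ ↦ ψ d * ((N : ℂ) * m * z + d) ^ (-(2 : ℤ)) := by
  have h := (linear_right_summable (z : ℂ) ((N : ℤ) * m) (k := 2) le_rfl).norm
  refine Summable.of_norm_bounded h fun d ↦ ?_
  rw [norm_mul, _root_.zpow_neg]
  push_cast
  exact mul_le_of_le_one_left (norm_nonneg _) (ψ.norm_le_one _)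

/-- **The row `c = 0` in weight `2`**: `∑_{d ∈ ℤ} ψ(d) d^{-2} = 2 L(2, ψ)` for `ψ` even.
[cite: DiamondShurman2005, §4.5–4.6] -/
theorem charRowTwo_zero (hpar : ψ (-1) = 1) :
    ∑' d : ℤ, ψ d * ((N : ℂ) * ((0 : ℤ) : ℂ) * z + d) ^ (-(2 : ℤ)) = 2 * ψ.LFunction 2 := by
  have hpar' : ψ (-1) = (-1) ^ 2 := by rw [hpar]; norm_num
  simp only [Int.cast_zero, mul_zero, zero_mul, zero_add]
  have hs : Summable fun d : ℤ ↦ ψ d * ((d : ℤ) : ℂ) ^ (-(2 : ℤ)) := by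
    simpa using summable_charRowTwo ψ z 0
  have heven : Function.Even fun d : ℤ ↦ ψ d * ((d : ℤ) : ℂ) ^ (-(2 : ℤ)) := by
    intro d
    have := apply_neg_mul_neg_zpow 2 ψ hpar' d ((d : ℤ) : ℂ)
    push_cast at this ⊢
    exact this
  rw [tsum_int_eq_zero_add_two_mul_tsum_pnat heven hs]
  simp only [Int.cast_zero]
  rw [zero_zpow _ (by norm_num), mul_zero, zero_add, nsmul_eq_mul, Nat.cast_ofNat]
  congr 1
  have hre : 1 < ((2 : ℂ)).re := by norm_num
  rw [DirichletCharacter.LFunction_eq_LSeries ψ hre, LSeries]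
  have h0 : (fun n : ℕ ↦ LSeries.term (fun n : ℕ ↦ ψ n) 2 n) 0 = 0 := LSeries.term_zero _ _
  rw [← tsum_pnat_eq_tsum_of_eq_zero (M := ℂ) h0]
  refine tsum_congr fun n ↦ ?_
  rw [LSeries.term_of_ne_zero (PNat.ne_zero n), div_eq_mul_inv,
    show ((n : ℕ) : ℂ) ^ (2 : ℂ) = ((n : ℕ) : ℂ) ^ (2 : ℕ) from Complex.cpow_ofNat _ 2,
    ← zpow_natCast, ← _root_.zpow_neg]
  push_cast
  rfl

/-- **One residue class of a row** (`m > 0`, weight `2`): with `w = mz + x̃/N ∈ ℍ`,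
`∑_j ψ(jN + x̃) (Nmz + jN + x̃)^{-2} = ψ(x) N^{-2} (-2πi)² ∑_n n e^{2πinx̃/N} e^{2πinmz}`.
[cite: Miyake2006, Thm. 7.1.3 (k = 2)] -/
theorem tsum_residue_rowTwo {m : ℤ} (hm : 0 < m) (x : ZMod N) :
    ∑' j : ℤ, ψ (((j * N + (x.val : ℤ) : ℤ)) : ZMod N) *
        ((N : ℂ) * m * z + ((j * N + (x.val : ℤ) : ℤ) : ℂ)) ^ (-(2 : ℤ)) =
      ψ x * ((N : ℂ) ^ 2)⁻¹ * (-2 * π * Complex.I) ^ 2 *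
        ∑' n : ℕ, (n : ℂ) *
          (cexp (2 * π * Complex.I * x.val / N) ^ n * cexp (2 * π * Complex.I * m * z) ^ n) := by
  have hN : (N : ℂ) ≠ 0 := by exact_mod_cast NeZero.ne N
  have him : 0 < ((m : ℂ) * z + (x.val : ℂ) / N).im := by
    rw [Complex.add_im, Complex.div_natCast_im]
    simp only [Complex.mul_im, Complex.intCast_re, Complex.intCast_im, zero_mul, add_zero,
      Complex.natCast_im, UpperHalfPlane.coe_im, zero_div]
    exact mul_pos (Int.cast_pos.mpr hm) z.im_pos
  set w : ℍ := ⟨(m : ℂ) * z + (x.val : ℂ) / N, him⟩ with hw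
  have hwc : (w : ℂ) = (m : ℂ) * z + (x.val : ℂ) / N := rfl
  have hL := tsum_zpow_neg_eq_tsum_cexp (k := 2) le_rfl w
  simp only [Nat.cast_ofNat, show (2 : ℕ) - 1 = 1 from rfl, Nat.factorial_one, Nat.cast_one,
    div_one, pow_one] at hL
  have hterm : ∀ j : ℤ, ψ (((j * N + (x.val : ℤ) : ℤ)) : ZMod N) *
      ((N : ℂ) * m * z + ((j * N + (x.val : ℤ) : ℤ) : ℂ)) ^ (-(2 : ℤ)) =
      ψ x * ((N : ℂ) ^ 2)⁻¹ * ((w : ℂ) + j) ^ (-(2 : ℤ)) := by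
    intro j
    rw [intCast_mul_add_val]
    have h : ((N : ℂ) * m * z + ((j * N + (x.val : ℤ) : ℤ) : ℂ)) = (N : ℂ) * ((w : ℂ) + j) := by
      rw [hwc]
      push_cast
      field_simp
      ring
    rw [h, mul_zpow, _root_.zpow_neg (N : ℂ), zpow_ofNat, mul_assoc]
  simp_rw [hterm]
  rw [tsum_mul_left, hL, ← mul_assoc]
  congr 1
  refine tsum_congr fun n ↦ ?_
  rw [← mul_pow, ← Complex.exp_add, hwc]
  congr 3
  ring

/-- **The rows `m > 0` in weight `2`** for a primitive `ψ`:
`R_m = N^{-2} (-2πi)² W(ψ) ∑_{n ≥ 0} ψ̄(n) n e^{2πinmz}`. [cite: Miyake2006, Thm. 7.1.3 (k = 2)] -/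
theorem charRowTwo_pos (hψ : ψ.IsPrimitive) {m : ℤ} (hm : 0 < m) :
    ∑' d : ℤ, ψ d * ((N : ℂ) * m * z + d) ^ (-(2 : ℤ)) =
      ((N : ℂ) ^ 2)⁻¹ * (-2 * π * Complex.I) ^ 2 * gaussSum ψ (ZMod.stdAddChar (N := N)) *
        ∑' n : ℕ, ψ⁻¹ n * (n : ℂ) * cexp (2 * π * Complex.I * m * z) ^ n := by
  rw [tsum_int_eq_sum_zmod_tsum N (summable_charRowTwo ψ z m)]
  rw [Finset.sum_congr rfl fun x _ ↦ tsum_residue_rowTwo ψ z hm x]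
  have hq : ∀ x : ZMod N, Summable fun n : ℕ ↦ (n : ℂ) *
      (cexp (2 * π * Complex.I * x.val / N) ^ n * cexp (2 * π * Complex.I * m * z) ^ n) := by
    intro x
    have him : 0 < ((m : ℂ) * z + (x.val : ℂ) / N).im := by
      rw [Complex.add_im, Complex.div_natCast_im]
      simp only [Complex.mul_im, Complex.intCast_re, Complex.intCast_im, zero_mul, add_zero,
        Complex.natCast_im, UpperHalfPlane.coe_im, zero_div]
      exact mul_pos (Int.cast_pos.mpr hm) z.im_pos
    have h1 := summable_pow_mul_cexp_pow 1 ⟨_, him⟩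
    simp only [pow_one] at h1
    refine h1.congr fun n ↦ ?_
    rw [← mul_pow, ← Complex.exp_add]
    congr 3
    ring
  calc ∑ x : ZMod N, ψ x * ((N : ℂ) ^ 2)⁻¹ * (-2 * π * Complex.I) ^ 2 *
        ∑' n : ℕ, (n : ℂ) *
          (cexp (2 * π * Complex.I * x.val / N) ^ n * cexp (2 * π * Complex.I * m * z) ^ n)
      = ((N : ℂ) ^ 2)⁻¹ * (-2 * π * Complex.I) ^ 2 *
        ∑' n : ℕ, ∑ x : ZMod N, ψ x * cexp (2 * π * Complex.I * x.val / N) ^ n *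
          ((n : ℂ) * cexp (2 * π * Complex.I * m * z) ^ n) := by
        rw [Summable.tsum_finsetSum fun x _ ↦ ((hq x).mul_left (ψ x)).congr fun n ↦ by ring,
          Finset.mul_sum]
        refine Finset.sum_congr rfl fun x _ ↦ ?_
        rw [← tsum_mul_left, ← tsum_mul_left]
        refine tsum_congr fun n ↦ ?_
        ring
    _ = _ := by
        rw [mul_assoc (((N : ℂ) ^ 2)⁻¹ * _) (gaussSum ψ _), ← tsum_mul_left (a := gaussSum ψ _)]
        congr 1
        refine tsum_congr fun n ↦ ?_
        rw [← Finset.sum_mul, sum_apply_mul_cexp_pow ψ hψ n]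
        ring

end RowsTwo

/-! ### `S_χ` as `N²` times the sum of the weight-`2` rows with character `χ̄` -/

section Regroup

variable {N : ℕ} [NeZero N] (χ : DirichletCharacter ℂ N) (τ : ℍ)

/-- The `χ̄`-combination of the lattice summands of the `f_{(0,e)}`: the level-one part cancels
(`∑_e χ̄(e) = 0` for `χ ≠ 1`). [folklore] -/
theorem sum_inv_mul_weierstrassPDiv_summand (hχ1 : χ ≠ 1) (x : Fin 2 → ℤ) :
    ∑ e : ZMod N, χ⁻¹ e *
        ((N : ℂ) ^ 2 * eisSummand 2 (![0, (e.val : ℤ)] - (N : ℤ) • x) τ - eisSummand 2 x τ) =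
      (N : ℂ) ^ 2 * ∑ e : ZMod N, χ⁻¹ e * eisSummand 2 (![0, (e.val : ℤ)] - (N : ℤ) • x) τ := by
  have h0 : ∑ e : ZMod N, χ⁻¹ e = 0 := MulChar.sum_eq_zero_of_ne_one (inv_ne_one.mpr hχ1)
  simp_rw [mul_sub, Finset.sum_sub_distrib, ← Finset.sum_mul, h0, zero_mul, sub_zero,
    Finset.mul_sum]
  refine Finset.sum_congr rfl fun e _ ↦ ?_
  ring

/-- The regrouped summand `H(a, b) = ∑_e χ̄(e) (Naτ + (bN + ẽ))^{-2}` equals the `χ̄`-combination of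
the lattice summands at `x = (-a, -b)` (divided by `N²`). [folklore] -/
theorem sum_inv_mul_eisSummand_neg (a b : ℤ) :
    ∑ e : ZMod N, χ⁻¹ e * eisSummand 2 (![0, (e.val : ℤ)] - (N : ℤ) • ![-a, -b]) τ =
      ∑ e : ZMod N, χ⁻¹ e * ((N : ℂ) * a * τ + ((b * N + (e.val : ℤ) : ℤ) : ℂ)) ^ (-(2 : ℤ)) := by
  refine Finset.sum_congr rfl fun e _ ↦ ?_
  congr 1
  rw [eisSummand]
  have h0 : ((![0, (e.val : ℤ)] - (N : ℤ) • ![-a, -b]) 0 : ℤ) = N * a := by simp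
  have h1 : ((![0, (e.val : ℤ)] - (N : ℤ) • ![-a, -b]) 1 : ℤ) = b * N + e.val := by
    simp
    ring
  rw [h0, h1]
  push_cast
  ring_nf

/-- The regrouped family `H` on `ℤ × ℤ` is summable (transport of the summability of the lattice
sums of the `f_{(0,e)}`; `χ ≠ 1`). [folklore] -/
theorem summable_sum_inv_mul_zpow (hχ1 : χ ≠ 1) :
    Summable fun p : ℤ × ℤ ↦ ∑ e : ZMod N, χ⁻¹ e *
      ((N : ℂ) * p.1 * τ + ((p.2 * N + (e.val : ℤ) : ℤ) : ℂ)) ^ (-(2 : ℤ)) := by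
  have hN0 : (N : ℂ) ≠ 0 := by exact_mod_cast NeZero.ne N
  have hS : Summable fun x : Fin 2 → ℤ ↦ ∑ e : ZMod N, χ⁻¹ e *
      ((N : ℂ) ^ 2 * eisSummand 2 (![0, (e.val : ℤ)] - (N : ℤ) • x) τ - eisSummand 2 x τ) :=
    summable_sum fun e _ ↦
      (summable_weierstrassPDiv (NeZero.ne N) ![0, (e.val : ℤ)] τ).mul_left (χ⁻¹ e)
  have hG : Summable fun x : Fin 2 → ℤ ↦
      ∑ e : ZMod N, χ⁻¹ e * eisSummand 2 (![0, (e.val : ℤ)] - (N : ℤ) • x) τ := by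
    refine (hS.mul_left (((N : ℂ) ^ 2)⁻¹)).congr fun x ↦ ?_
    rw [sum_inv_mul_weierstrassPDiv_summand χ τ hχ1 x, ← mul_assoc,
      inv_mul_cancel₀ (pow_ne_zero _ hN0), one_mul]
  have h2 := (finTwoArrowEquiv ℤ).symm.summable_iff.mpr hG
  have h3 := (Equiv.neg (ℤ × ℤ)).summable_iff.mpr h2
  refine h3.congr fun p ↦ ?_
  simp only [Function.comp_apply, Equiv.neg_apply, finTwoArrowEquiv_symm_apply, Prod.fst_neg,
    Prod.snd_neg]
  exact sum_inv_mul_eisSummand_neg χ τ p.1 p.2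

/-- **Residue regrouping of one row**:
`∑_{b ∈ ℤ} ∑_{e mod N} χ̄(e) (Naτ + (bN + ẽ))^{-2} = ∑_{d ∈ ℤ} χ̄(d) (Naτ + d)^{-2} = R_a`.
[folklore] -/
theorem tsum_sum_inv_mul_zpow_row (a : ℤ) :
    ∑' b : ℤ, ∑ e : ZMod N, χ⁻¹ e *
        ((N : ℂ) * a * τ + ((b * N + (e.val : ℤ) : ℤ) : ℂ)) ^ (-(2 : ℤ)) =
      ∑' d : ℤ, χ⁻¹ d * ((N : ℂ) * a * τ + d) ^ (-(2 : ℤ)) := by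
  have hF := summable_charRowTwo χ⁻¹ τ a
  have hN : N ≠ 0 := NeZero.ne N
  have he : ∀ e : ZMod N, Summable fun b : ℤ ↦ χ⁻¹ e *
      ((N : ℂ) * a * τ + ((b * N + (e.val : ℤ) : ℤ) : ℂ)) ^ (-(2 : ℤ)) := by
    intro e
    have h := hF.comp_injective (i := fun b : ℤ ↦ b * N + (e.val : ℤ))
      (fun b b' hbb' ↦ by simpa [hN] using hbb')
    refine h.congr fun b ↦ ?_
    simp only [Function.comp_apply, intCast_mul_add_val]
  rw [tsum_int_eq_sum_zmod_tsum N hF, Summable.tsum_finsetSum fun e _ ↦ he e]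
  refine Finset.sum_congr rfl fun e _ ↦ tsum_congr fun b ↦ ?_
  rw [intCast_mul_add_val]

/-- **`S_χ = N² ∑_{c ∈ ℤ} R_c`**, `R_c = ∑_{d ∈ ℤ} χ̄(d) (Ncτ + d)^{-2}`, for `χ ≠ 1`.
[cite: DiamondShurman2005, §4.6] -/
theorem weierstrassPDivChar_eq_tsum_rows (hχ1 : χ ≠ 1) :
    weierstrassPDivChar χ τ =
      (N : ℂ) ^ 2 * ∑' c : ℤ, ∑' d : ℤ, χ⁻¹ d * ((N : ℂ) * c * τ + d) ^ (-(2 : ℤ)) := by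
  have hT : ∀ e : ZMod N, Summable fun x : Fin 2 → ℤ ↦
      (N : ℂ) ^ 2 * eisSummand 2 (![0, (e.val : ℤ)] - (N : ℤ) • x) τ - eisSummand 2 x τ :=
    fun e ↦ summable_weierstrassPDiv (NeZero.ne N) _ τ
  have h1 : weierstrassPDivChar χ τ = ∑' x : Fin 2 → ℤ, ∑ e : ZMod N, χ⁻¹ e *
      ((N : ℂ) ^ 2 * eisSummand 2 (![0, (e.val : ℤ)] - (N : ℤ) • x) τ - eisSummand 2 x τ) := by
    rw [weierstrassPDivChar, Summable.tsum_finsetSum (fun e _ ↦ (hT e).mul_left (χ⁻¹ e))]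
    refine Finset.sum_congr rfl fun e _ ↦ ?_
    rw [weierstrassPDiv, tsum_mul_left]
  rw [h1, tsum_congr (fun x ↦ sum_inv_mul_weierstrassPDiv_summand χ τ hχ1 x), tsum_mul_left]
  congr 1
  rw [← (finTwoArrowEquiv ℤ).symm.tsum_eq, ← (Equiv.neg (ℤ × ℤ)).tsum_eq]
  have hH := summable_sum_inv_mul_zpow χ τ hχ1
  rw [show (fun p : ℤ × ℤ ↦ ∑ e : ZMod N, χ⁻¹ e *
      eisSummand 2 (![0, (e.val : ℤ)] - (N : ℤ) • (finTwoArrowEquiv ℤ).symm (Equiv.neg (ℤ × ℤ) p))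
        τ) = fun p : ℤ × ℤ ↦ ∑ e : ZMod N, χ⁻¹ e *
      ((N : ℂ) * p.1 * τ + ((p.2 * N + (e.val : ℤ) : ℤ) : ℂ)) ^ (-(2 : ℤ)) from ?_]
  · rw [hH.tsum_prod]
    exact tsum_congr fun a ↦ tsum_sum_inv_mul_zpow_row χ τ a
  · funext p
    simp only [Equiv.neg_apply, finTwoArrowEquiv_symm_apply, Prod.fst_neg, Prod.snd_neg]
    exact sum_inv_mul_eisSummand_neg χ τ p.1 p.2

/-- The family of rows `c ↦ R_c` is summable (`χ ≠ 1`). [folklore] -/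
theorem summable_tsum_charRowTwo (hχ1 : χ ≠ 1) :
    Summable fun c : ℤ ↦ ∑' d : ℤ, χ⁻¹ d * ((N : ℂ) * c * τ + d) ^ (-(2 : ℤ)) :=
  ((summable_sum_inv_mul_zpow χ τ hχ1).prod).congr fun a ↦ tsum_sum_inv_mul_zpow_row χ τ a

end Regroup

/-! ### The `q`-expansion of `S_χ` -/

section QExpansion

variable {N : ℕ} [NeZero N] (χ : DirichletCharacter ℂ N) (τ : ℍ)

/-- **The `q`-expansion of `S_χ`** for `χ` primitive, non-trivial and even:
`S_χ(τ) = 2N² L(2, χ̄) + 2 (-2πi)² W(χ̄) ∑_{n ≥ 1} (∑_{d ∣ n} χ(d) d) qⁿ`.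
[cite: DiamondShurman2005, Thm. 4.6.2 and §4.8; Miyake2006, Thm. 7.2.12] -/
theorem weierstrassPDivChar_eq_qExpansion (hχ : χ.IsPrimitive) (hχ1 : χ ≠ 1)
    (heven : χ (-1) = 1) :
    weierstrassPDivChar χ τ = 2 * (N : ℂ) ^ 2 * χ⁻¹.LFunction 2 +
      2 * ((-2 * π * Complex.I) ^ 2 * gaussSum χ⁻¹ (ZMod.stdAddChar (N := N))) *
        ∑' n : ℕ+, (∑ d ∈ (n : ℕ).divisors, χ d * (d : ℂ)) *
          cexp (2 * π * Complex.I * τ) ^ (n : ℕ) := by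
  have hN0 : (N : ℂ) ≠ 0 := by exact_mod_cast NeZero.ne N
  have hinv1 : χ⁻¹ (-1) = 1 := by rw [MulChar.inv_apply_eq_inv', heven, inv_one]
  have hpar : χ⁻¹ (-1) = (-1) ^ 2 := by rw [hinv1]; norm_num
  have hprim : χ⁻¹.IsPrimitive := isPrimitive_inv χ hχ
  rw [weierstrassPDivChar_eq_tsum_rows χ τ hχ1]
  have hev : Function.Even fun m : ℤ ↦
      ∑' d : ℤ, χ⁻¹ d * ((N : ℂ) * m * τ + d) ^ (-(2 : ℤ)) := by
    intro m
    have h := eisLatticeCharRow_neg 2 χ⁻¹ τ hpar m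
    push_cast at h
    simpa using h
  rw [tsum_int_eq_zero_add_two_mul_tsum_pnat hev (summable_tsum_charRowTwo χ τ hχ1),
    charRowTwo_zero χ⁻¹ τ hinv1, nsmul_eq_mul, Nat.cast_ofNat]
  have hpos : ∀ m : ℕ+, (0 : ℤ) < ((m : ℕ) : ℤ) := fun m ↦ by exact_mod_cast m.pos
  rw [show (∑' m : ℕ+, ∑' d : ℤ, χ⁻¹ d * ((N : ℂ) * ((m : ℕ) : ℤ) * τ + d) ^ (-(2 : ℤ))) =
      ∑' m : ℕ+, ((N : ℂ) ^ 2)⁻¹ * (-2 * π * Complex.I) ^ 2 *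
        gaussSum χ⁻¹ (ZMod.stdAddChar (N := N)) *
        ∑' n : ℕ, χ⁻¹⁻¹ n * (n : ℂ) * cexp (2 * π * Complex.I * ((m : ℕ) : ℤ) * τ) ^ n
      from tsum_congr fun m ↦ charRowTwo_pos χ⁻¹ τ hprim (hpos m), tsum_mul_left, inv_inv]
  have hq : ‖cexp (2 * π * Complex.I * τ)‖ < 1 := norm_exp_two_pi_I_lt_one τ
  have hinner : ∀ m : ℕ+,
      ∑' n : ℕ, χ n * (n : ℂ) * cexp (2 * π * Complex.I * ((m : ℕ) : ℤ) * τ) ^ n =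
        ∑' n : ℕ+, χ n * (n : ℂ) ^ 1 *
          cexp (2 * π * Complex.I * τ) ^ ((m : ℕ) * n : ℕ) := by
    intro m
    have h0 : (fun n : ℕ ↦ χ n * (n : ℂ) *
        cexp (2 * π * Complex.I * ((m : ℕ) : ℤ) * τ) ^ n) 0 = 0 := by
      simp only [Nat.cast_zero, mul_zero, zero_mul]
    rw [← tsum_pnat_eq_tsum_of_eq_zero (M := ℂ) h0]
    refine tsum_congr fun n ↦ ?_
    rw [pow_one, pow_mul, ← Complex.exp_nat_mul (2 * π * Complex.I * τ) m]
    congr 3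
    push_cast
    ring
  simp_rw [hinner]
  rw [← (summable_prod_weight_mul_pow 1 hq (fun d ↦ χ d) (fun d ↦ χ.norm_le_one _)).tsum_prod,
    tsum_prod_mul_pow_eq_tsum_divisorSum 1 hq (fun d ↦ χ d) (fun d ↦ χ.norm_le_one _)]
  simp only [pow_one]
  field_simp

end QExpansion

end Literature.NumberTheory.EllipticCurves.ModularForms
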